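import Literature.IUT.HodgeArakelov.ThetaEnvDataRecordAutSaturatedOfGalois
import Literature.IUT.HodgeArakelov.EtaleThetaDataOfSettingRootHypOfCor28i
import Literature.IUT.HodgeArakelov.EtaleThetaDataOfSettingRootHypOfCor28iInner

/-!
# [IUTchII] Prop 3.4 (i) at the GENUINE data — statement of record of node IUTchII:Prop3.4(i) with the root binder
# (P4) `hroot` SUPPLIED ALONG ROUTE 2: [EtTh] Prop 2.4 (F-0609) + Cor 2.8 (i) (F-0640) at the orbit data `ofEmbedding`

S. Mochizuki, *Inter-universal Teichmüller theory II*, kurims manuscript (Dec. 2020): Prop 3.4 (i) pp. 91–92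
[cite: Mochizuki2012, Prop 3.4 (i) p.91]; Prop 1.4 p. 27; Cor 1.11 (b) p. 49.  Claim key DISPUTED (D-0012).  Refereed
inputs BY NAME ([EtTh] = S. Mochizuki, Publ. RIMS **45** (2009)): Cor. 2.18 (i) p. 60 (= FACT F-0620), Prop. 2.4 p. 38
(= FACT F-0609 `TemperedCoverData.Prop24`), Cor. 2.8 (i) p. 42 (= FACT F-0640 `ThetaOrbitData.Cor28_i`), Thm. 1.6
(ii)/(iii) p. 24; [AbsAnab] Lem. 1.3.8 (`γ(Δ^tp_X) = Δ^tp_X`); [AbsTopIII] Cor. 1.10 pp. 41–44.  abc-iut cell, layer L6,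
WAVE-5 seat abc-iut-w5-d169 (gen 5; holder lineage of node IUTchII:Prop3.4(i) / `plan/L6/SUBDAG-IUTchII-Prop-31-33-34.md`);
GAP-LEDGER rows G-w5d169-2 (ROUTE 2 supplier: abc-iut-w5-d118 `EtaleThetaDataOfSetting.rootHyp_of_cor28_i`,
`EtaleThetaDataOfSettingRootHypOfCor28i.lean`; abc-iut-L2-lead R250; bookkeeper abc-iut-w4-d041) and G-w5d169-3 (`hgal`).

PROOF-ONLY assembly (no definition, no `Prop`-valued fact, nothing restated): this lineage's
`EtaleLevels.prop34i_multiradiallyDefined_saturated_ofGalois` (p437226) with the root hypothesis (P4) `hroot` :=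
abc-iut-w5-d118's `rootHyp_of_cor28_i` — per `α ∈ Aut_top(Π^tp_X̲̲)`: extend `α` along the orbit embedding
`ι : Π^tp_X ↪ Π^tp_C` (`hιe`, `hιX`) to `Γ ∈ Aut_top(Π^tp_C)` stabilising the Prop 2.4 tower (F-0609 `h24`), restrict to
`γ ∈ Aut_top(Π^tp_X)` (`Thm16i γ`; abc-iut-w5-d072's CONSTRUCTED theta companion under `hΔ`), unpack F-0640 `h28` at
`ThetaOrbitData.ofEmbedding ε hC hS` (standard type `hstd`, `Dtau` permuted `hDtau`), and read the resulting cocycle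
identity on `Π^tp_Ÿ̲̲` (abc-iut-w4-d041's door `rootHyp_of_forall_extends_transport`, p436936).
* **`EtaleLevels.prop34i_multiradiallyDefined_saturated_ofCor28i`** — [IUTchII] Prop 3.4 (i) MULTIRADIALITY OF SPLIT
  THETA MONOIDS AT THE GENUINE FUNCTOR (saturated index set, constants `ℚ̄_pˣ ⊇ O` through `ε`, genuine Kummer map),
  residual BY NAME exactly: F-0620 · F-0609 · F-0640 (FACTS) · `hq` (origin clause R3) · `hO'` (`IsEtThOrigin`) ·
  `hιe`/`hιX` (the orbit embedding is an open embedding onto `Π^tp_X` — theorems at abc-iut-L2-d3's cover) · `hstd`,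
  `hDtau` (standing hypotheses of F-0640) · `hΔ` ([AbsAnab] Lem. 1.3.8 shape) · `hgal` = (HGAL) ∧ (HCYC) (G-w5d169-3;
  D-row 2026-08-26T11:4xZ: (HCYC) ⟸ (HGAL) route) · the standing record/tower inputs.
* **`EtaleLevels.exists_coeff_prop34i_multiradiallyDefined_saturated_ofCor28i`** — the same with the coefficient datum
  `c` DISCHARGED from the tower (abc-iut-w4-d007's `exists_cyclotomeCoefficients_of_cyclotomeTower`, under `hO'` + `hΔc`).
Sibling consumers of the same node statement along ROUTE 1: `…_saturated_ofCore` (p439139), `…_ofExtendsTransport`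
(abc-iut-w4-d041 p438115).  Nothing here asserts anything of [IUTchII] or [EtTh]; no side taken on [IUTchIII] Cor 3.12;
typed ≠ proved for the binders.
-/

noncomputable section

open Topology

namespace Literature.IUT.HodgeArakelov

open Literature.AnabelianGeometry.EtaleTheta Literature.AnabelianGeometry.SemiGraphs
open CohomologySystemOfContH1 EtaleThetaDataOfSetting TemperedThetaMonoids ThetaCovers
open scoped Literature.AnabelianGeometry.EtaleTheta

namespace EtaleLevels

universe u

variable {p : ℕ} [Fact p.Prime] {D : Literature.AnabelianGeometry.EtaleTheta.ThetaSetting p}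
  {E : D.EtaleThetaData} {l : ℕ} (C : E.DoubleUnderline l) (hC : D.Compat) (hS : D.Sec2Hyps)
  (hl : l.Prime) (hp2 : p ≠ 2) (hpl : p ≠ l) (hζ : ∃ ζ : D.K, IsPrimitiveRoot ζ (4 * l))
  (mods : ∀ M : ℕ+, D.CyclotomeMod l M)
  (f : contCocycles D.toTheta D.DeltaTheta C.GtpYdduu) (hf : f ∈ C.rootCocycles hC)
  (hmods : ∀ (M M' : ℕ+) (h : (M : ℕ) ∣ (M' : ℕ)) (x : D.lDeltaTheta l),
    MuN.red p M M' h ((mods M').red x) = (mods M).red x)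
  (h15 : Literature.AnabelianGeometry.EtaleTheta.ThetaSetting.Prop15iii E hC) (L : C.CuspLabels)
  (hZ : ∀ M : ℕ+, Nonempty (ModelCyclotomes.lDeltaQuot (C.rigidData (mods M) hC hS h15 L) ≃*
    Literature.IUT.HodgeTheaters.ZHat))
  (hcharY : EtaleThetaDataOfSetting.PiYddCharacteristic C)
  (hlim : Function.Bijective (rigidLimHom C hC hS hl hp2 hpl hζ mods f hf hmods h15 L hZ))
  [(EtaleThetaDataOfSetting.PiYdd C).Normal]
  (hq : IsQuotientMap D.toTheta) {N : ℕ+} (μ : D.CyclotomeMod l N)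
  (R : RigidData.{0} N l) (hR : R = C.rigidData μ hC hS h15 L) (h218i : R.Cor218_i)
  -- ROUTE 2 inputs (abc-iut-w5-d118 `rootHyp_of_cor28_i`)
  {T : TemperedCoverData.{u} l} (ε : C.OrbitEmbedding T)
  (hιe : IsOpenEmbedding ε.ι) (hιX : ε.ι.range = T.tp T.PiX)
  (hΔ : ∀ γ : D.PiTemp ≃ₜ* D.PiTemp, D.DeltaTemp.map γ.toMulEquiv.toMonoidHom = D.DeltaTemp)
  (h24 : T.Prop24) (hstd : (ThetaOrbitData.ofEmbedding ε hC hS).IsStandard)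
  (h28 : (ThetaOrbitData.ofEmbedding ε hC hS).Cor28_i)
  (hDtau : ∀ Γ : T.Gtp ≃ₜ* T.Gtp, (∀ S ∈ T.tower, S.map Γ.toMulEquiv.toMonoidHom = S) →
    ∀ Dt ∈ (ThetaOrbitData.ofEmbedding ε hC hS).Dtau,
      Dt.map Γ.toMulEquiv.toMonoidHom ∈ (ThetaOrbitData.ofEmbedding ε hC hS).Dtau)
  -- index / constants / origin / (P3)
  (ι₀ : (Pi C) ≃ₜ* (Pi C))
  {Es : Set ℕ+} (τw : D.CyclotomeTower l Es)
  (O : Submonoid (PadicAlgCl p)ˣ)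
  (hO : ∀ (σ : GQp p) (u : (PadicAlgCl p)ˣ), u ∈ O → Units.map (σ : PadicAlgCl p →* PadicAlgCl p) u ∈ O)
  (hO' : D.IsEtThOrigin)
  (hgal : ∀ α : (Pi C) ≃ₜ* (Pi C), ∃ τ : GQp p,
    (∀ x : Pi C, aug C (α x) = τ * aug C x * τ⁻¹) ∧
    (∀ (M : ℕ+) (z w : D.lDeltaTheta l),
      ((rangeAutOfCor218i C μ hq hC hS h15 L R hR h218i α
          ⟨(z : D.GtpTheta), lDeltaTheta_le_phiRange C z.2⟩ : phiRange C) : D.GtpTheta) = (w : D.GtpTheta) →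
        (τw.modAll M).red w = galMuN p M τ ((τw.modAll M).red z)))

/-- **[IUTchII] Prop 3.4 (i) — MULTIRADIALITY OF SPLIT THETA MONOIDS AT THE GENUINE FUNCTOR, root binder along
ROUTE 2**: (P1) := {F-0620, `hq`}; (P2) none (saturated index set); (P3) := `hgal` = (HGAL) ∧ (HCYC); (P4) := `hroot` FROM
F-0609 (`h24`) + F-0640 (`h28`, `hstd`, `hDtau`) + `hΔ` along the orbit embedding `ε` (`hιe`, `hιX`)
(abc-iut-w5-d118's `rootHyp_of_cor28_i`). [cite: Mochizuki2012, Prop 3.4 (i) p.92] -/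
theorem prop34i_multiradiallyDefined_saturated_ofCor28i
    (c : CyclotomeCoefficients (phi C) (D.lDeltaTheta l) (PadicAlgCl p)ˣ)
    (hlev : ∀ (ζ : cyclotome (PadicAlgCl p)ˣ) (M : ℕ+),
      (((τw.modAll M).red (c.hom ζ) : MuN p M) : (PadicAlgCl p)ˣ) = (ζ : ℕ+ → (PadicAlgCl p)ˣ) M)
    {η : (C.thetaEnvData μ hC hS).PiYdd → MuN p N} (hη : η ∈ (C.thetaEnvData μ hC hS).thetaCocycles)
    (Γ : Type) [Group Γ] :
    haveI := hC.GtpYdd_normal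
    ((ex18iii (ThetaSetting.ofDoubleUnderline C μ hC hS hl hp2 hpl hζ hη) Γ).toDagger
      (TemperedThetaMonoids.prop34iRadialFunctor
        (thetaEnvTransportS C hC hS hl hp2 hpl hζ mods f hf hmods h15 L hZ hcharY hlim hq μ R hR h218i
          (h1LimKummerOn (phi C) (D.lDeltaTheta l) (PiYdd C) c (isOpen_stabilizer_units C)
            (finiteIndex_stabilizer_units C) O) ι₀
          (map_mrange_h1LimKummerOn_eq_of_galois C hq μ τw c hlev O hO hC hS h15 L R hR h218i hO' hgal)
          (image_toLim_theta_thetaEnvData_of_rootHyp C hC hS hl hp2 hpl hζ mods f hf hmods h15 L hZ hcharY hlim hq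
            μ R hR h218i
            (rootHyp_of_cor28_i C ε hq μ hC hS h15 L R hR h218i hιe hιX hΔ h24 hstd h28 hDtau))
          (image_thetaInfty_thetaEnvData_of_rootHyp C hC hS hl hp2 hpl hζ mods f hf hmods h15 L hZ hcharY hlim hq μ
            R hR h218i
            (rootHyp_of_cor28_i C ε hq μ hC hS h15 L R hR h218i hιe hιX hΔ h24 hstd h28 hDtau)) hη)
        Γ)).IsMultiradiallyDefined := by
  haveI := hC.GtpYdd_normal
  exact prop34i_multiradiallyDefined_saturated_ofGalois C hC hS hl hp2 hpl hζ mods f hf hmods h15 L hZ hcharY hlim hq μ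
    R hR h218i (rootHyp_of_cor28_i C ε hq μ hC hS h15 L R hR h218i hιe hιX hΔ h24 hstd h28 hDtau) ι₀ τw O hO hO'
    hgal c hlev hη Γ

/-- **The same with the coefficient datum DISCHARGED** (`exists_cyclotomeCoefficients_of_cyclotomeTower` under `hO'` +
`hΔc`): residual BY NAME {F-0620, F-0609, F-0640, `hq`, `hO'`, `hΔc`, `hιe`/`hιX`, `hstd`, `hDtau`, `hΔ`, `hgal`} plus the
standing record/tower inputs. [cite: Mochizuki2012, Prop 3.4 (i) p.92] -/
theorem exists_coeff_prop34i_multiradiallyDefined_saturated_ofCor28i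
    (hΔc : IsCompact (D.DeltaTheta : Set D.GtpTheta))
    {η : (C.thetaEnvData μ hC hS).PiYdd → MuN p N} (hη : η ∈ (C.thetaEnvData μ hC hS).thetaCocycles)
    (Γ : Type) [Group Γ] :
    haveI := hC.GtpYdd_normal
    ∃ (c : CyclotomeCoefficients (phi C) (D.lDeltaTheta l) (PadicAlgCl p)ˣ)
      (hlev : ∀ (ζ : cyclotome (PadicAlgCl p)ˣ) (M : ℕ+),
        (((τw.modAll M).red (c.hom ζ) : MuN p M) : (PadicAlgCl p)ˣ) = (ζ : ℕ+ → (PadicAlgCl p)ˣ) M),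
      Function.Bijective c.hom ∧
      ((ex18iii (ThetaSetting.ofDoubleUnderline C μ hC hS hl hp2 hpl hζ hη) Γ).toDagger
        (TemperedThetaMonoids.prop34iRadialFunctor
          (thetaEnvTransportS C hC hS hl hp2 hpl hζ mods f hf hmods h15 L hZ hcharY hlim hq μ R hR h218i
            (h1LimKummerOn (phi C) (D.lDeltaTheta l) (PiYdd C) c (isOpen_stabilizer_units C)
              (finiteIndex_stabilizer_units C) O) ι₀
            (map_mrange_h1LimKummerOn_eq_of_galois C hq μ τw c hlev O hO hC hS h15 L R hR h218i hO' hgal)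
            (image_toLim_theta_thetaEnvData_of_rootHyp C hC hS hl hp2 hpl hζ mods f hf hmods h15 L hZ hcharY hlim hq
              μ R hR h218i
              (rootHyp_of_cor28_i C ε hq μ hC hS h15 L R hR h218i hιe hιX hΔ h24 hstd h28 hDtau))
            (image_thetaInfty_thetaEnvData_of_rootHyp C hC hS hl hp2 hpl hζ mods f hf hmods h15 L hZ hcharY hlim hq
              μ R hR h218i
              (rootHyp_of_cor28_i C ε hq μ hC hS h15 L R hR h218i hιe hιX hΔ h24 hstd h28 hDtau)) hη)
          Γ)).IsMultiradiallyDefined := by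
  haveI := hC.GtpYdd_normal
  exact exists_coeff_prop34i_multiradiallyDefined_saturated_ofGalois C hC hS hl hp2 hpl hζ mods f hf hmods h15 L hZ
    hcharY hlim hq μ R hR h218i (rootHyp_of_cor28_i C ε hq μ hC hS h15 L R hR h218i hιe hιX hΔ h24 hstd h28 hDtau) ι₀
    τw O hO hO' hgal hΔc hη Γ

/-! ### v2 (abc-iut-w5-d118, FINDING F-w5d118g5-1): `Dtau`-stability only up to an inner automorphism from `Π^tp_{X̲̲}` -/

/-- **[IUTchII] Prop 3.4 (i) at the genuine functor, root binder along ROUTE 2, v2**: as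
`prop34i_multiradiallyDefined_saturated_ofCor28i` but with the `Dtau` clause of Cor 2.8 (i) asked only UP TO AN INNER
AUTOMORPHISM from `Π^tp_{X̲̲}` (`hDtau'`; abc-iut-w5-d118's `rootHyp_of_cor28_i_innerAdjust`, p445404) — residual BY NAME
{F-0620, `hq`, F-0609, F-0640, `hstd`, `hDtau'`, `hΔ`, `hιe`/`hιX`, `hgal`}. [cite: Mochizuki2012, Prop 3.4 (i) p.92] -/
theorem prop34i_multiradiallyDefined_saturated_ofCor28i_innerAdjust
    (hDtau' : ∀ Γ : T.Gtp ≃ₜ* T.Gtp, (∀ S ∈ T.tower, S.map Γ.toMulEquiv.toMonoidHom = S) →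
      ∃ u ∈ C.Huu, ∀ Dt ∈ (ThetaOrbitData.ofEmbedding ε hC hS).Dtau,
        Dt.map (Γ.trans (ThetaOrbitData.innerAutTop (ε.ι u))).toMulEquiv.toMonoidHom ∈
          (ThetaOrbitData.ofEmbedding ε hC hS).Dtau)
    (c : CyclotomeCoefficients (phi C) (D.lDeltaTheta l) (PadicAlgCl p)ˣ)
    (hlev : ∀ (ζ : cyclotome (PadicAlgCl p)ˣ) (M : ℕ+),
      (((τw.modAll M).red (c.hom ζ) : MuN p M) : (PadicAlgCl p)ˣ) = (ζ : ℕ+ → (PadicAlgCl p)ˣ) M)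
    {η : (C.thetaEnvData μ hC hS).PiYdd → MuN p N} (hη : η ∈ (C.thetaEnvData μ hC hS).thetaCocycles)
    (Γ : Type) [Group Γ] :
    haveI := hC.GtpYdd_normal
    ((ex18iii (ThetaSetting.ofDoubleUnderline C μ hC hS hl hp2 hpl hζ hη) Γ).toDagger
      (TemperedThetaMonoids.prop34iRadialFunctor
        (thetaEnvTransportS C hC hS hl hp2 hpl hζ mods f hf hmods h15 L hZ hcharY hlim hq μ R hR h218i
          (h1LimKummerOn (phi C) (D.lDeltaTheta l) (PiYdd C) c (isOpen_stabilizer_units C)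
            (finiteIndex_stabilizer_units C) O) ι₀
          (map_mrange_h1LimKummerOn_eq_of_galois C hq μ τw c hlev O hO hC hS h15 L R hR h218i hO' hgal)
          (image_toLim_theta_thetaEnvData_of_rootHyp C hC hS hl hp2 hpl hζ mods f hf hmods h15 L hZ hcharY hlim hq
            μ R hR h218i
            (rootHyp_of_cor28_i_innerAdjust C ε hq μ hC hS h15 L R hR h218i hιe hιX hΔ h24 hstd h28 hDtau'))
          (image_thetaInfty_thetaEnvData_of_rootHyp C hC hS hl hp2 hpl hζ mods f hf hmods h15 L hZ hcharY hlim hq μ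
            R hR h218i
            (rootHyp_of_cor28_i_innerAdjust C ε hq μ hC hS h15 L R hR h218i hιe hιX hΔ h24 hstd h28 hDtau')) hη)
        Γ)).IsMultiradiallyDefined := by
  haveI := hC.GtpYdd_normal
  exact prop34i_multiradiallyDefined_saturated_ofGalois C hC hS hl hp2 hpl hζ mods f hf hmods h15 L hZ hcharY hlim hq μ
    R hR h218i (rootHyp_of_cor28_i_innerAdjust C ε hq μ hC hS h15 L R hR h218i hιe hιX hΔ h24 hstd h28 hDtau') ι₀ τw O
    hO hO' hgal c hlev hη Γ

end EtaleLevels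

end Literature.IUT.HodgeArakelov

end
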